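import Literature.NumberTheory.EllipticCurves.Kim2025.StructureClauseOPEN
import Literature.NumberTheory.EllipticCurves.KuriharaNumberKimStructure
import HarnessLib

/-!
# Kim 2025 (arXiv:2505.09121v1, PREPRINT), Thm. 1.1 (corank and structure clauses), Thm. 1.2
# (rk1+ε) with Cor. 1.10, Cor. 1.11 and Prop. 2.5 — read in weight `2` for elliptic curves over `ℚ`
# at EVERY prime `p ≥ 3` under large `p`-adic image, typed as explicitly labelled OPEN hypotheses

Topic `NumberTheory/EllipticCurves`, sub-directory `Kim2025` (namespace = path). Third file of the
story, after `LargeImageStructureOPEN` (rank-`0` shapes of Cor. 1.7, rank-`1` unit certificate) and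
`StructureClauseOPEN` (Thm. 1.1 ("BSD") LENGTH clause at every rank): this file types the clauses
of the paper's two main theorems that those files do NOT carry. Written by the cross-ladder
literature-typing layer (cell `bsd-littype`, seat 09; D-0088(4)). HONEST FRAMING (cell, verbatim):
"no tranche here proves BSD … typed ≠ proved ≠ endorsed". The source is an UNREFEREED PREPRINT
(arXiv v1, May 2025; no journal version found 2026-08-26): every statement below taken from it is a
`def … : Prop` named `…_OPEN` and tagged `[claim: Kim2025RefinedTNC, status: under-review]`;
nothing is asserted; a result using one of them is conditional on an unrefereed claim. The
REFEREED elliptic-curve form of Prop. 2.5 (parity vanishing of Kurihara numbers: Kim, Amer. J.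
Math. 148 (2026) Prop. 3.14; Kurihara 2014 Lemma 5.2.1) is typed separately as a genuine named fact
in the sibling `KuriharaNumberParity` (no import either way).

## The printed statements (held TeX-derived text `paper:arxiv-2505.09121`, chunk locators `pNNNN`)

* **Thm. 1.1** (Main Theorem I; §1.2.1, chunk p0004): "Let `f ∈ S_k(Γ₀(N))` be a newform and
  `p ≥ 3` a prime such that `ρ_f` has large image. If the collection of Kurihara numbers
  `δ^{min,†}` for `f` at `s = k/2` does not vanish, then … (Str) there exists an isomorphism of
  co-finitely generated `𝒪`-modules
  `Sel(ℚ, W_f^†) ≃ (F/𝒪)^{⊕ ord(δ^{min,†})} ⊕ ⨁_{i≥0} (𝒪/π^{e_i}𝒪)^{⊕2}` where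
  `e_i = ½·(∂^{(ord(δ^{min,†})+2i)}(δ^{min,†}) − ∂^{(ord(δ^{min,†})+2i+2)}(δ^{min,†}))`;
  ("BSD") `cork_𝒪 Sel(ℚ, W_f^†) = ord(δ^{min,†})`,
  `length_𝒪 Sel(ℚ, W_f^†)_{/div} = ∂^{(ord(δ^{min,†}))}(δ^{min,†}) − ∂^{(∞)}(δ^{min,†})`."
  Followed by: "Theorem 1.1 is independent of weight or the local behavior of `f` at `p`."
* **Thm. 1.2** (Main Theorem II; §1.2.2, chunk p0005): "Let `f ∈ S_k(Γ₀(N))` be a newform and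
  `p ≥ 3` a prime such that `ρ_f` has large image. If one of the following conditions is
  satisfied: (rk0) `ord_{s=k/2} L(f,s) = 0`, (rk1+ε) `ord_{s=k/2} L(f,s) = 1`, `p² ∤ N`,
  `α_p ≠ β_p` (when `p ∤ N`), and Assumption 1.3 below holds, (IMC at 𝟙) …, or (ord) `p ≥ 5`, `f` is
  good ordinary at `p`, and `f` is `p`-distinguished, then `δ^{min,†}` does not vanish. Conversely,
  if `δ^{min,†}` does not vanish, then the Iwasawa main conjecture for `T_f^†` localized at the
  augmentation ideal holds." — with "It is conjectured that `α_p ≠ β_p` always holds and is true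
  when `k = 2`", Rem. 1.4 "(AJ) holds when `k = 2` … (loc_p) follows from the finiteness of the
  `π`-primary part of Tate–Shafarevich groups … when `k = 2` and the Selmer corank is one", and the
  proof of Cor. 1.10: "Since the weight of `f` is two and `ord_{s=1} L(f,s) ≤ 1`, Assumption 1.3
  is automatic."
* **Cor. 1.10** (§1.3.4, chunk p0007): "Let `f ∈ S₂(Γ₀(N))` be a newform and `p ≥ 3` a prime such
  that `p² ∤ N` and `ρ_f` has large image. … If `ord_{s=1} L(f,s) ≤ 1`, then we have
  `cork_𝒪 Sel(ℚ, W_f(1)) = dim_F(A_f(ℚ) ⊗_R F) = ord(δ^{can,†}) = ord_{s=1} L(f,s)`,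
  `Ш(A_f/ℚ)[π^∞] ≃ ⨁_{i≥0} (𝒪/π^{e_i}𝒪)^{⊕2}` … In particular,
  `length_𝒪 Ш(A_f/ℚ)[π^∞] = ∂^{(ord(δ^{can,†}))}(δ^{can,†}) − ∂^{(∞)}(δ^{can,†})`." ("It goes beyond
  the standard Euler system argument, but it does not use the Iwasawa main conjecture at all.")
* **Cor. 1.11** (§1.3.5, chunk p0007): "Let `f ∈ S_k(Γ₀(N))` be a newform and `p ≥ 3` a prime
  such that `ρ_f` has large image. If `δ^{min,†}_n ≠ 0` for some `n ∈ 𝒩_1`, then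
  `cork_𝒪 Sel(ℚ, W_f^†) ≤ ν(n)`."
* **Prop. 2.5** (§2.3.4, chunk p0010; `ψ = 1`, `r = k/2`): "(2.1)
  `w(f)·(−1)^{ν(n)}·δ^{min,†}_n = δ^{min,†}_n ∈ 𝒪/I_n𝒪` … If `(−1)^{ν(n)} ≠ w(f)`, then
  `δ^{min,†}_n = 0`. … This vanishing is independent of the normalization of modular symbols." For
  elliptic curves this is REFEREED: C.-H. Kim, Amer. J. Math. 148 (2026) 79–129, eq. (3.3) and
  Prop. 3.14 (= arXiv:2203.12159v3 Prop. 3.16, held chunk p0019): "`w(E)·(−1)^{ν(n)}·δ̃_n = δ̃_n ∈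
  ℤ_p/I_nℤ_p` where `w(E)` is the root number of `E`. … If `(−1)^{ν(n)} ≠ w(E)`, then `δ̃_n = 0`",
  and M. Kurihara, *Iwasawa Theory 2012* (2014), Lemma 5.2.1 (mod `p`, from Mazur–Tate (1.6.2)).
* §1.1.1 (chunk p0004): "`ρ_f` has large image if the image of `Gal(ℚ̄/ℚ(μ_{p^∞}))` under `ρ_f`
  contains a conjugate of `SL₂(ℤ_p)`"; §1.1.2–1.1.3: `𝒩_m`, `I_n`, `ν(n)`, `ord`, `∂^{(i)}`,
  `∂^{(∞)}`; §1.4.4 (chunk p0008): "Any non-minimal integral periods can play the exactly same role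
  in Theorems 1.1 and 1.8 without any modification"; Rem. 5.5 / §5.3.2–5.3.4 (chunk p0018–p0019):
  the level witnessing `ord = cork` is chosen "in the standard Kolyvagin system argument
  [mazur-rubin-book]" inside `𝒩_m` with `m ≫ 0`.

## Dictionary (as in the two sibling files; `k = 2`, `𝒪 = ℤ_p`, `f = f_E`)

`W/ℚ` a globally minimal elliptic curve, `f ∈ S₂(Γ₀(N))` its newform (`IsNewformOf W f`);
`W_f^† = W_f(1) ≅ E[p^∞]`, `Sel(ℚ, W_f(1)) = Sel_{p^∞}(E/ℚ)`, `cork_{ℤ_p} = W.selmerCorank p`. LARGE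
IMAGE is rendered, as in the siblings, by the full tower `ρ̄_{E,p^n}` onto for all `n` (⇒ `ρ_{E,p^∞}
(G_{ℚ(μ_{p^∞})}) = SL₂(ℤ_p)`). KURIHARA NUMBERS: the tree's `kuriharaNumber f (p^k) n ψ ∈ ℤ/p^k`
(`Ω⁺_f`-normalised) at levels `n ∈ 𝒩_k` (`Kato.IsKolyvaginProduct W p k n`: `I_n ⊆ p^kℤ_p`, so
`δ̃_n mod p^k` is defined and `δ̃_n^{(k)} ≠ 0 ⇒ δ̃_n ≠ 0 in ℤ_p/I_n`); the invariants
`kuriharaVanishingOrder` (`ord`), `kuriharaPartial` (`∂^{(i)}`), `kuriharaPartialInfty` (`∂^{(∞)}`)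
of `KuriharaNumberInvariants`, all over the CYCLIC Kolyvagin levels `#Ẽ(𝔽_ℓ)[p] ≤ p` of the printed
PROOF (Mazur–Rubin's primes; flag `Kim2026-(6)-cyclic-reading` of `Kim2026/ShaLengthStructure`;
Kim 2025 Rem. 5.5 chooses the witnessing level among these). PERIOD: Kim's `δ^{min}` is normalised by
the minimal integral period (Def. 2.2); here, as in `cor17_…_of_integralPeriod_OPEN`, the hypothesis
"`Ω⁺_f` is an integral period" — `0 ≤ ord_p [r]⁺_f` whenever `[r]⁺_f ≠ 0` — is carried, so that
`Ω⁺_f = p^{w}·u·Ω_min` with `w ≤ 0`, `|u|_p = 1`, every `Ω⁺_f`-normalised number is a genuine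
reduction, non-vanishing of `δ̃^{Ω⁺_f}_n mod I_n` implies that of `δ^{min}_n`, and the DIFFERENCES
`∂^{(a)} − ∂^{(b)}` and `ord` are those of `δ^{min}` (§1.4.4; for `ord` use the witness of Rem. 5.5,
which lies in `𝒩_m`, `m ≫ 0`, with divisibility `∂^{(∞)} < ∞`). `Sel_{/div}`: with `Ш(E/ℚ)` finite
(binder `Finite W.sha`, as in the siblings) the divisible part of `Sel_{p^∞}(E/ℚ)` is
`E(ℚ) ⊗ ℚ_p/ℤ_p` and `Sel_{/div} ≅ Ш(E/ℚ)[p^∞] = AddCommGroup.primaryComponent W.sha p`.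

## What is here / not here

Five `_OPEN` `Prop`s (Thm. 1.1 corank clause; Thm. 1.1 (Str) for `Ш[p^∞]`; Cor. 1.11; Thm. 1.2
(rk1+ε) with Cor. 1.10 in analytic rank `1`; the `p ≥ 3` twin of Prop. 2.5 — its refereed `p ≥ 5`
elliptic-curve form, Kim AJM Prop. 3.14, is the named fact of the sibling `KuriharaNumberParity`),
and PROVED bookkeeping: Cor. 1.10's rank-one length and rank formulas assembled from (rk1+ε) and the
length / corank clauses. All
weaker than print (weight `2` only; `Finite W.sha`; tower; cyclic levels; integral-period binder),
never stronger. NOT typable in the tree's vocabulary (no Bloch–Kato Selmer groups of higher-weight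
forms, no `Λ`-adic / Kolyvagin-system objects): Thm. 1.1 (Non-triv), Thm. 1.2 (IMC at 𝟙) and its
converse, (ord) beyond the elliptic-curve case already in `KuriharaNumberKimNonvanishing` (`p ≥ 5`),
Thm. 1.8, Cor. 1.5/1.9, Thm. 1.12, §7. Conjectures 1.6 / 7.1 / 7.4 / 7.5 are not Literature
(CONVENTIONS §4) and are listed for the ideation cells in the cell's OPEN-QUESTIONS-09.md. The
parity fact is dischargeable in the tree (Fricke symmetry, Hecke relation and Taylor functionals are
all proved; route in `KuriharaNumberParity`); size M, not attempted by this typing seat.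

## References
* C.-H. Kim (appendix with R. Pollack), arXiv:2505.09121v1 (2025): §1.1.1–1.1.3, Thm. 1.1, Thm. 1.2,
  Assumption 1.3, Rem. 1.4, Cor. 1.10, Cor. 1.11, §1.4.4, Def. 2.2, Rem. 2.3, Def. 2.4, Prop. 2.5,
  §3.2.2, Thm. 3.12, Rem. 5.5, §5.3–5.4. [Kim2025RefinedTNC]
* C.-H. Kim, Amer. J. Math. 148 (2026) 79–129 = arXiv:2203.12159: §3.5 eq. (3.3), Prop. 3.14
  (journal; = v3 Prop. 3.16), Thm. 1.8 (1) (journal; = v4 Thm. 1.9). [Kim2022StructureSelmer]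
* M. Kurihara, in *Iwasawa Theory 2012*, Contrib. Math. Comput. Sci. 7 (2014), Lemma 5.2.1. [Kurihara2014]
* B. Mazur, J. Tate, Duke Math. J. 54 (1987), (1.6.2). [MazurTate1987]
* R. Sakamoto, J. Théor. Nombres Bordeaux 36 (2024) 919–946, Thm. 1.1 (the refereed `p = 3`
  Kolyvagin-system input of Kim 2025 §3.2.2 / Prop. 3.4). [Sakamoto2024KolyvaginThree]
* M. Bertolini, H. Darmon, R. Venerucci, Adv. Math. 398 (2022) (Perrin-Riou's conjecture; the input
  of (rk1+ε)). [BertoliniDarmonVenerucci2022]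
-/

noncomputable section

open scoped MatrixGroups ModularForm Classical

open CongruenceSubgroup Literature.NumberTheory.EllipticCurves.ModularForms
  Literature.NumberTheory.EllipticCurves

namespace Literature.NumberTheory.EllipticCurves.Kim2025

/-! ### Thm. 1.1 ("BSD"), FIRST clause: the Selmer corank is the vanishing order -/

/-- **OPEN HYPOTHESIS — UNREFEREED PREPRINT (arXiv:2505.09121v1, 2025), Thm. 1.1 ("BSD") first
clause `cork_𝒪 Sel(ℚ, W_f^†) = ord(δ^{min,†})`, weight `2`, EVERY prime `p ≥ 3` under large image,
ANY reduction type at `p`, in the own-currency normalisation of the siblings.** Transcribed (module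
docstring DICTIONARY): `W/ℚ` globally minimal elliptic with newform `f`, `p ≥ 3` with `ρ̄_{E,p^n}`
onto for all `n`, `Ω⁺_f` an integral period; then for every `r : ℕ` with `ord(δ̃) = r`
(`kuriharaVanishingOrder W p f = r` — so the collection does not vanish) the `ℤ_p`-corank of
`Sel_{p^∞}(E/ℚ)` is `r`. The `p ≥ 5`, `ρ̄_{E,p}`-onto, upper-direction twin in the period-transfer
normalisation is the PUBLISHED `Kim2022_selmerCorank_le_of_kuriharaNumber_ne_zero` (Kim AJM Thm. 1.8
(1)). The `p = 3` case rests on Sakamoto, JTNB 36 (2024) Thm. 1.1 (REFEREED) via §3.2.2 / Prop. 3.4.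
NEVER cite this `Prop` as a theorem; explicit hypothesis only. Weaker than the announced print
(weight `2`; tower; cyclic levels; integral-period binder), never stronger.
[claim: Kim2025RefinedTNC, status: under-review]
[cite: Kim2025RefinedTNC, Thm. 1.1 ("BSD") first clause (§1.2.1, chunk p0004), §1.1.1–1.1.3, §1.4.4, Rem. 5.5 and §5.3 (chunks p0018–p0019) (ANNOUNCED, typed as an OPEN hypothesis, nothing asserted)]
[cite: Sakamoto2024KolyvaginThree, Thm. 1.1 = Thm. 4.4 (p. 920)]
[cite: Kim2022StructureSelmer, Thm. 1.8 (1) (journal) = arXiv v4 Thm. 1.9 (1) (PDF p. 7)] -/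
def thm11_selmerCorank_eq_of_kuriharaVanishingOrder_eq_OPEN : Prop :=
  ∀ (W : WeierstrassCurve ℚ) [W.IsElliptic] [W.IsGloballyMinimal] (p : ℕ) [Fact p.Prime],
    3 ≤ p → (∀ n : ℕ, W.HasSurjectiveModNGaloisRep (p ^ n : ℕ)) →
    ∀ {N : ℕ} [NeZero N] (f : CuspForm (Gamma0 N) 2), IsNewformOf W f →
    (∀ r : ℚ, ratPlusSymbol f r ≠ 0 → 0 ≤ padicValRat p (ratPlusSymbol f r)) →
    ∀ r : ℕ, kuriharaVanishingOrder W p f = r → W.selmerCorank p = r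

/-! ### Thm. 1.1 (Str): the module structure of `Ш(E/ℚ)[p^∞]` from the `∂`-invariants -/

/-- **OPEN HYPOTHESIS — UNREFEREED PREPRINT (arXiv:2505.09121v1, 2025), Thm. 1.1 (Str), weight
`2`, EVERY prime `p ≥ 3` under large image, read on `Sel_{/div} = Ш(E/ℚ)[p^∞]` (with `Ш(E/ℚ)`
finite):** "`Sel(ℚ, W_f^†) ≃ (F/𝒪)^{⊕ ord} ⊕ ⨁_{i≥0} (𝒪/π^{e_i}𝒪)^{⊕2}`,
`e_i = ½·(∂^{(ord+2i)} − ∂^{(ord+2i+2)})`" (by Thm. 3.12 the `e_i` are non-negative, non-increasing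
and eventually `0`). Transcribed: `W/ℚ` globally minimal with newform `f`, `p ≥ 3`, tower, `Ш(E/ℚ)`
finite, `Ω⁺_f` an integral period; for every `r : ℕ` with `ord(δ̃) = r` there are `m : ℕ` and
exponents `e : ℕ → ℕ`, vanishing from `m` on, with
`∂^{(r+2i)}(δ̃) = ∂^{(r+2i+2)}(δ̃) + 2·e_i` in `ℕ∞` for every `i` (both sides finite, Thm. 3.12) and
an additive isomorphism `Ш(E/ℚ)[p^∞] ≃ ⨁_{i<m} (ℤ/p^{e_i})^{⊕2}`. Implies the LENGTH clause
`thm11_kimShaLength_of_integralPeriod_OPEN` of the sibling file (telescoping) and, in analytic rank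
`≤ 1` with `p² ∤ N`, is Cor. 1.10's "`Ш(A_f/ℚ)[π^∞] ≃ ⨁ (𝒪/π^{e_i})^{⊕2}`". The `p = 3` case rests
on Sakamoto 2024 (REFEREED). NEVER cite this `Prop` as a theorem; explicit hypothesis only. Weaker
than the announced print, never stronger. [claim: Kim2025RefinedTNC, status: under-review]
[cite: Kim2025RefinedTNC, Thm. 1.1 (Str) and eq. (1.2) (§1.2.1, chunk p0004), Thm. 3.12 (chunk p0013), §5.4 (chunks p0019–p0020), Cor. 1.10 (chunk p0007) (ANNOUNCED, typed as an OPEN hypothesis, nothing asserted)]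
[cite: Sakamoto2024KolyvaginThree, Thm. 1.1 = Thm. 4.4 (p. 920)] -/
def thm11_sha_structure_of_kuriharaVanishingOrder_eq_OPEN : Prop :=
  ∀ (W : WeierstrassCurve ℚ) [W.IsElliptic] [W.IsGloballyMinimal] (p : ℕ) [Fact p.Prime],
    3 ≤ p → (∀ n : ℕ, W.HasSurjectiveModNGaloisRep (p ^ n : ℕ)) → Finite W.sha →
    ∀ {N : ℕ} [NeZero N] (f : CuspForm (Gamma0 N) 2), IsNewformOf W f →
    (∀ r : ℚ, ratPlusSymbol f r ≠ 0 → 0 ≤ padicValRat p (ratPlusSymbol f r)) →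
    ∀ r : ℕ, kuriharaVanishingOrder W p f = r →
      ∃ (m : ℕ) (e : ℕ → ℕ),
        (∀ i : ℕ, kuriharaPartial W p f (r + 2 * i) =
            kuriharaPartial W p f (r + 2 * i + 2) + ((2 * e i : ℕ) : ℕ∞)) ∧
        (∀ i : ℕ, m ≤ i → e i = 0) ∧
        Nonempty (AddCommGroup.primaryComponent W.sha p ≃+
          ((i : Fin m) → ZMod (p ^ e i) × ZMod (p ^ e i)))

/-! ### Cor. 1.11: the computational upper bound of the Selmer corank -/

/-- **OPEN HYPOTHESIS — UNREFEREED PREPRINT (arXiv:2505.09121v1, 2025), Cor. 1.11, weight `2`,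
EVERY prime `p ≥ 3` under large image, ANY reduction type at `p`:** "If `δ^{min,†}_n ≠ 0` for some
`n ∈ 𝒩_1`, then `cork_𝒪 Sel(ℚ, W_f^†) ≤ ν(n)`." Transcribed: `W/ℚ` globally minimal with newform
`f`, `p ≥ 3`, tower, `Ω⁺_f` an integral period; `k ≥ 1`, `n ∈ 𝒩_k` a CYCLIC level
(`#Ẽ(𝔽_ℓ)[p] ≤ p` for `ℓ ∣ n`), surjective discrete logarithms `ψ_ℓ : (ℤ/ℓ)ˣ ↠ ℤ/p^k` with
`kuriharaNumber f (p^k) n ψ ≠ 0` (so `δ̃_n ∉ I_n ⊆ p^kℤ_p`, hence `δ^{min}_n ≠ 0`, DICTIONARY);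
then `W.selmerCorank p ≤ #primeFactors n`. Binders follow the PUBLISHED `p ≥ 5` good-ordinary twin
`Kim2022_selmerCorank_le_of_kuriharaNumber_ne_zero` (Kim AJM Thm. 1.8 (1)) except
`5 ≤ p → good → ordinary → ρ̄_{E,p} onto → period transfer` ↦ `3 ≤ p → tower → integral period`
and the cyclicity flag of the printed proof; use the published fact at a good ordinary `p ≥ 5`. This
is the shape consumed by the high-rank examples of App. A.1.5 (`(ℚ_p/ℤ_p)^{⊕2,3,4}` rows, chunk
p0027). The `p = 3` case rests on Sakamoto 2024 (REFEREED). NEVER cite this `Prop` as a theorem;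
explicit hypothesis only. Weaker than the announced print, never stronger.
[claim: Kim2025RefinedTNC, status: under-review]
[cite: Kim2025RefinedTNC, Cor. 1.11 (§1.3.5, chunk p0007), §1.1.2, Def. 2.4, §1.4.4 (ANNOUNCED, typed as an OPEN hypothesis, nothing asserted)]
[cite: Sakamoto2024KolyvaginThree, Thm. 1.1 = Thm. 4.4 (p. 920)]
[cite: Kim2022StructureSelmer, Thm. 1.8 (1) (journal) = arXiv v4 Thm. 1.9 (1) (PDF p. 7)] -/
def cor111_selmerCorank_le_of_kuriharaNumber_ne_zero_OPEN : Prop :=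
  ∀ (W : WeierstrassCurve ℚ) [W.IsElliptic] [W.IsGloballyMinimal] (p : ℕ) [Fact p.Prime],
    3 ≤ p → (∀ n : ℕ, W.HasSurjectiveModNGaloisRep (p ^ n : ℕ)) →
    ∀ {N : ℕ} [NeZero N] (f : CuspForm (Gamma0 N) 2), IsNewformOf W f →
    (∀ r : ℚ, ratPlusSymbol f r ≠ 0 → 0 ≤ padicValRat p (ratPlusSymbol f r)) →
    ∀ (k n : ℕ) [NeZero n], 1 ≤ k → Kato.IsKolyvaginProduct W p k n →
    (∀ (ℓ : ℕ) [Fact ℓ.Prime], ℓ ∣ n →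
      Nat.card {P : ((WeierstrassCurve.integralModelInt W).map
          (Int.castRingHom (ZMod ℓ))).toAffine.Point // p • P = 0} ≤ p) →
    ∀ ψ : (ℓ : ℕ) → (ZMod ℓ)ˣ →* Multiplicative (ZMod (p ^ k)),
      (∀ ℓ ∈ n.primeFactors, Function.Surjective (ψ ℓ)) →
      kuriharaNumber f (p ^ k) n ψ ≠ 0 →
    W.selmerCorank p ≤ n.primeFactors.card

/-! ### Thm. 1.2 (rk1+ε) with Cor. 1.10: in analytic rank one the vanishing order is one -/

/-- **OPEN HYPOTHESIS — UNREFEREED PREPRINT (arXiv:2505.09121v1, 2025), Thm. 1.2 (rk1+ε) with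
Cor. 1.10, weight `2`, EVERY prime `p ≥ 3` with `p² ∤ N` under large image:** Thm. 1.2: "(rk1+ε)
`ord_{s=k/2} L(f,s) = 1`, `p² ∤ N`, `α_p ≠ β_p` (when `p ∤ N`) [true when `k = 2`], and Assumption
1.3 [automatic for `k = 2`, `ord ≤ 1`: proof of Cor. 1.10] … then `δ^{min,†}` does not vanish";
Cor. 1.10: "`cork_𝒪 Sel(ℚ, W_f(1)) = dim_F(A_f(ℚ) ⊗_R F) = ord(δ^{can,†}) = ord_{s=1} L(f,s)`".
Transcribed in analytic rank ONE: `W/ℚ` globally minimal with newform `f`, `p ≥ 3` with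
`p² ∤ N_E` (`W.conductorNorm ℤ`), tower, `L(E,1) = 0` and `ord_{s=1} L(E,s) = 1`, `Ω⁺_f` an
integral period; then `ord(δ̃) = 1` (`kuriharaVanishingOrder W p f = 1`: `δ̃_1 = [0]⁺_f = 0` and some
cyclic Kolyvagin PRIME `ℓ` has `δ̃_ℓ ≠ 0 in ℤ_p/I_ℓ` — the witness of Rem. 5.5 / §5.3). No
Iwasawa-theoretic input and NO per-pair certificate enters (the printed input is
Bertolini–Darmon–Venerucci 2022, Thm. A, on Perrin-Riou's prediction for Kato's zeta element);
contrast the sibling `rankOne_card_sha_eq_one_…_OPEN`, which ASSUMES a unit `δ̃_ℓ`. With `thm11_kimShaLength_of_integralPeriod_OPEN` it yields Cor. 1.10's rank-one length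
formula (`cor110_rankOne_kimShaLength`, proved below). The `p = 3` case (so `9 ∤ N`) rests on
Sakamoto 2024 (REFEREED). NEVER cite this `Prop` as a theorem; explicit hypothesis only. Weaker than
the announced print, never stronger. [claim: Kim2025RefinedTNC, status: under-review]
[cite: Kim2025RefinedTNC, Thm. 1.2 (rk1+ε), Assumption 1.3, Rem. 1.4 (§1.2.2, chunk p0005), Cor. 1.10 (§1.3.4, chunk p0007), Rem. 5.5 (chunk p0018) (ANNOUNCED, typed as an OPEN hypothesis, nothing asserted)]
[cite: BertoliniDarmonVenerucci2022, Thm. A] [cite: Sakamoto2024KolyvaginThree, Thm. 1.1 = Thm. 4.4 (p. 920)] -/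
def thm12_kuriharaVanishingOrder_eq_one_of_analyticRank_eq_one_OPEN : Prop :=
  ∀ (W : WeierstrassCurve ℚ) [W.IsElliptic] [W.IsGloballyMinimal] (p : ℕ) [Fact p.Prime],
    3 ≤ p → ¬ p ^ 2 ∣ W.conductorNorm ℤ → (∀ n : ℕ, W.HasSurjectiveModNGaloisRep (p ^ n : ℕ)) →
    W.entireLFunction 1 = 0 → W.analyticRank = 1 →
    ∀ {N : ℕ} [NeZero N] (f : CuspForm (Gamma0 N) 2), IsNewformOf W f →
    (∀ r : ℚ, ratPlusSymbol f r ≠ 0 → 0 ≤ padicValRat p (ratPlusSymbol f r)) →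
    kuriharaVanishingOrder W p f = 1

/-! ### Prop. 2.5 (for elliptic curves = Kim AJM Prop. 3.14, REFEREED, file `KuriharaNumberParity`) -/

/-- **OPEN HYPOTHESIS — UNREFEREED PREPRINT (arXiv:2505.09121v1, 2025), Prop. 2.5 at EVERY prime
`p ≥ 3` under large image, weight `2`:** "If `(−1)^{ν(n)} ≠ w(f)`, then `δ^{min,†}_n = 0`. … This
vanishing is independent of the normalization of modular symbols." For elliptic curves at `p ≥ 5`,
`ρ̄_{E,p}` onto, this is the REFEREED Kim AJM 148 (2026) Prop. 3.14 / Kurihara 2014 Lemma 5.2.1, typed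
as the named fact `Kim2022_kuriharaNumber_eq_zero_of_neg_one_pow_ne_rootNumber` (file
`KuriharaNumberParity`, same binders with `5 ≤ p → ρ̄_{E,p} onto` in place of `3 ≤ p → tower`; use
it at `p ≥ 5`). Transcribed: `W` globally minimal with newform `f`, `p ≥ 3`, tower, `k ≥ 1`,
`n ∈ 𝒩_k` (`I_n ⊆ p^kℤ_p`); if `(−1)^{ν(n)} ≠ w(E)` then `kuriharaNumber f (p^k) n ψ = 0` for every
family of discrete logarithms `ψ` (vanishing is normalisation-free). An elementary consequence of Mazur–Tate's functional
equation (1.6.2), typed OPEN only because its printed `p = 3` locus is the preprint. NEVER cite this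
`Prop` as a theorem; explicit hypothesis only. [claim: Kim2025RefinedTNC, status: under-review]
[cite: Kim2025RefinedTNC, Prop. 2.5 and eq. (2.1) (§2.3.4, chunk p0010) (ANNOUNCED, typed as an OPEN hypothesis, nothing asserted)]
[cite: MazurTate1987, (1.6.2)] -/
def prop25_kuriharaNumber_eq_zero_of_neg_one_pow_ne_rootNumber_OPEN : Prop :=
  ∀ (W : WeierstrassCurve ℚ) [W.IsElliptic] [W.IsGloballyMinimal] (p : ℕ) [Fact p.Prime],
    3 ≤ p → (∀ m : ℕ, W.HasSurjectiveModNGaloisRep (p ^ m : ℕ)) →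
    ∀ {N : ℕ} [NeZero N] (f : CuspForm (Gamma0 N) 2), IsNewformOf W f →
    ∀ (k n : ℕ) [NeZero n], 1 ≤ k → Kato.IsKolyvaginProduct W p k n →
    (-1 : ℤ) ^ n.primeFactors.card ≠ W.rootNumber →
    ∀ ψ : (ℓ : ℕ) → (ZMod ℓ)ˣ →* Multiplicative (ZMod (p ^ k)), kuriharaNumber f (p ^ k) n ψ = 0

/-! ### Proved bookkeeping -/

section Bookkeeping

variable (W : WeierstrassCurve ℚ) [W.IsElliptic] [W.IsGloballyMinimal] (p : ℕ) [Fact p.Prime]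

/-- **Cor. 1.10 in analytic rank one, LENGTH form, assembled** (both inputs OPEN): under `p ≥ 3`,
`p² ∤ N_E`, tower, `L(E,1) = 0`, `ord_{s=1} L(E,s) = 1`, `Ш(E/ℚ)` finite, newform `f` with `Ω⁺_f`
integral, (rk1+ε) gives `ord(δ̃) = 1` and the length clause of Thm. 1.1 then reads
`∂^{(1)}(δ̃) = ord_p #Ш(E/ℚ)(p) + ∂^{(∞)}(δ̃)` with `∂^{(∞)}(δ̃) = d ∈ ℕ` — Cor. 1.10's
"`length_𝒪 Ш(A_f/ℚ)[π^∞] = ∂^{(ord)}(δ^{can}) − ∂^{(∞)}(δ^{can})`" at `ord = 1`, certificate-free.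
[cite: Kim2025RefinedTNC, Cor. 1.10 (§1.3.4, chunk p0007) (ANNOUNCED; both hypotheses are OPEN Props)] -/
theorem cor110_rankOne_kimShaLength
    (h12 : thm12_kuriharaVanishingOrder_eq_one_of_analyticRank_eq_one_OPEN)
    (h11 : thm11_kimShaLength_of_integralPeriod_OPEN)
    (hp : 3 ≤ p) (hN : ¬ p ^ 2 ∣ W.conductorNorm ℤ)
    (htower : ∀ n : ℕ, W.HasSurjectiveModNGaloisRep (p ^ n : ℕ))
    (hL : W.entireLFunction 1 = 0) (hrk : W.analyticRank = 1) (hfin : Finite W.sha)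
    {N : ℕ} [NeZero N] (f : CuspForm (Gamma0 N) 2) (hf : IsNewformOf W f)
    (hint : ∀ r : ℚ, ratPlusSymbol f r ≠ 0 → 0 ≤ padicValRat p (ratPlusSymbol f r)) :
    ∃ d : ℕ, kuriharaPartialInfty W p f = d ∧
      kuriharaPartial W p f 1 =
        ((padicValNat p (Nat.card (AddCommGroup.primaryComponent W.sha p)) + d : ℕ) : ℕ∞) :=
  h11 W p hp htower hfin f hf hint 1 (h12 W p hp hN htower hL hrk f hf hint)

/-- **Cor. 1.10 in analytic rank one, RANK form, assembled**: (rk1+ε) and the corank clause give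
`corank_{ℤ_p} Sel_{p^∞}(E/ℚ) = 1` at every `p ≥ 3` with `p² ∤ N_E` under large image — Cor. 1.10's
"`cork_𝒪 Sel(ℚ, W_f(1)) = ord_{s=1} L(f,s)`" at analytic rank `1` (for elliptic curves also a
consequence of Gross–Zagier–Kolyvagin; recorded to show the two OPEN clauses compose).
[cite: Kim2025RefinedTNC, Cor. 1.10 (§1.3.4, chunk p0007) (ANNOUNCED; both hypotheses are OPEN Props)] -/
theorem cor110_rankOne_selmerCorank_eq_one
    (h12 : thm12_kuriharaVanishingOrder_eq_one_of_analyticRank_eq_one_OPEN)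
    (h11 : thm11_selmerCorank_eq_of_kuriharaVanishingOrder_eq_OPEN)
    (hp : 3 ≤ p) (hN : ¬ p ^ 2 ∣ W.conductorNorm ℤ)
    (htower : ∀ n : ℕ, W.HasSurjectiveModNGaloisRep (p ^ n : ℕ))
    (hL : W.entireLFunction 1 = 0) (hrk : W.analyticRank = 1)
    {N : ℕ} [NeZero N] (f : CuspForm (Gamma0 N) 2) (hf : IsNewformOf W f)
    (hint : ∀ r : ℚ, ratPlusSymbol f r ≠ 0 → 0 ≤ padicValRat p (ratPlusSymbol f r)) :
    W.selmerCorank p = 1 :=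
  h11 W p hp htower f hf hint 1 (h12 W p hp hN htower hL hrk f hf hint)

end Bookkeeping

end Literature.NumberTheory.EllipticCurves.Kim2025

end
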